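import Literature.Barriers.AnomalousDissipation.GravestModeLaminarAttractorGalerkin
import Literature.Analysis.FluidPDE.StokesTorusProofs
import Literature.Analysis.FluidPDE.NSUniqueness2DProofs
import Literature.Analysis.FluidPDE.ZerothLaw
import Literature.Analysis.FluidPDE.TimeAverageMeasureBasic
import HarnessLib

/-!
# Marchioro's trivial attractor without zero momentum: the swept states are Leray–Hopf
(barrier-audit proof file of `Literature/Barriers/AnomalousDissipation/GravestModeLaminarAttractor`,
D-0021; Navier–Stokes-level companion of the Galilean drift family `marchioroDriftState` and of
the sharpened `scope_caveats:` / `evasions_known:` recorded there by the 2026-08-15 audit)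

Marchioro (CMP 105 (1986), p. 99, eq. (3)) and Foias–Manley–Rosa–Temam (2001, Ch. III (0.9),
PDF p. 136; "u₀ in H", p. 164) assume **zero space average of the velocity**; the barrier
statement `Marchioro1986_globalAttraction` carries this as `hmean : HasZeroMean u₀`, while the
summit `Literature.Turb.ZerothLaw` and the route crux `TwoAndHalfD.TwodBoundedEnergy` do not.
The parent file records (audit 2026-08-15) the *steady* drifting laminar states
`marchioroDriftState α ν c` and their algebra, and states in prose that drifting data evade the
"unbounded energy as `ν → 0`" consequence. This file proves that evasion **at the level of the
tree's Leray–Hopf solutions**, with fully explicit time-dependent solutions: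

* `marchioroSweptState α ν m t` — the exact solution of the 2-D Navier–Stokes equations on `𝕋²`
  with force `f_α = marchioroForce α`, zero pressure and **constant datum `u(0) ≡ m`**
  (total momentum `m`): in Fourier variables `ĉ(t)(0) = m`,
  `ĉ(t)(±e₀) = (1 - e^{-Λ_{±e₀}t}) Λ_{±e₀}⁻¹ f̂_α(±e₀)`, `Λ_k = 4π²ν|k|² + 2πi(m·k)` (Stokes
  damping plus the Doppler shift of a fluid sweeping past the stationary force pattern; FMRT
  2001, Ch. II (2.6)–(2.9)); as `t → ∞` it relaxes to the parent's steady `marchioroDriftState α ν m`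
  (`a + ib → α√2/(4π²ν + 2πim₀)`, i.e. `driftSinCoeff`, `driftCosCoeff`).
* `marchioroSweptState_isGlobalLerayHopf` — it **is a global Leray–Hopf solution** in the tree's
  sense (`Torus.IsGlobalLerayHopf`): the tree's Hopf–Galerkin scheme (`IsHopfGalerkinScheme`) is
  run with the *constant* sequence `U n = u`, whose Galerkin equations the explicit coefficients
  satisfy at every order (`galerkinField_sweptCoeff`: along these coefficients the nonlinear
  term is pure sweeping, `𝓕[(u·∇)u](k) = 2πi(m·k) ĉ(k)`), and
  `IsHopfGalerkinScheme.isLerayHopfOn_limit` applies with limit `u` itself.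
* `integral_norm_sq_marchioroSweptState_le` — `∫ ‖u(t)‖² ≤ ‖m‖² + 2α²/(π² m₀²)` for all
  `t ≥ 0`, **uniformly in `ν ≥ 0`**, when `m₀ = m 0 ≠ 0` (detuning: `|Λ_{±e₀}| ≥ 2π|m₀|`),
  whence `meanEnergy_marchioroSweptState_le`; and `meanDissipation_marchioroSweptState_le`:
  `⟨ν‖∇u‖²⟩ ≤ 8να²/m₀² → 0` — the evasion carries **no** anomalous dissipation.
* `exists_firstMode_boundedMeanEnergy_family` — there is a first-shell force `g ≠ 0` (smooth,
  divergence free, mean zero: `g = marchioroForce 1`), viscosities `ν_j = 1/(j+1) → 0` and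
  global Leray–Hopf solutions with `sup_j meanEnergy ≤ 1 + 2/π²`: **verbatim the shape of the
  crux `TwoAndHalfD.TwodBoundedEnergy`** (stmt-AnomalousDissipation-0209), which the barrier
  was recorded as killing for first-shell forces — the rigidity needs zero total momentum.
* `not_globalAttraction_without_zeroMean` — the statement of `Marchioro1986_globalAttraction`
  with the hypothesis `HasZeroMean u₀` deleted is **false** (the swept state with `m = e₀` stays
  at `L²`-distance `≥ 1` from `ū`).
* Robustness by 2-D uniqueness (`NS.lions_prodi_uniqueness_torus2_holds`): *every* global
  Leray–Hopf solution from the constant datum `u₀ ≡ m` agrees a.e. at positive times with the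
  swept state (`ae_eq_marchioroSweptState_of_isGlobalLerayHopf`), hence has the same ν-uniform
  energy and mean-energy bounds (`meanEnergy_le_of_isGlobalLerayHopf_const`) and, for `m = e₀`,
  stays at distance `≥ 1` from `ū` (`one_le_eLpNorm_sub_laminarState_of_isGlobalLerayHopf`).

What is *not* evaded (cf. the parent's `evasions_known:`): the dissipation of these states is
`2π²ν(a² + b²) → 0`, and every two-dimensional energy anomaly at bounded energy is excluded by
the companion barrier `AlexakisDoering2006_energyDissipationBound`; the gap concerns the
momentum bookkeeping of the summit and of the 2-D cruxes (which become trivial unless they impose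
`HasZeroMean` on the data), the scalar component of 2½-D witnesses, and three dimensions.

## References

* C. Marchioro, Comm. Math. Phys. 105 (1986) 99–106, eq. (3) and Theorem (p. 100).
* C. Foias, O. Manley, R. Rosa, R. Temam, *Navier–Stokes Equations and Turbulence*, CUP 2001,
  Ch. II §2 (2.4)–(2.9) (PDF pp. 45–46); Ch. III (0.9) (p. 136), (3.31)–(3.35) (pp. 163–164).
* J. C. Robinson, J. L. Rodrigo, W. Sadowski, *The three-dimensional Navier–Stokes equations*,
  CUP 2016, Thm. 4.4 (the Galerkin scheme, as formalised in `NSHopfGalerkinExistence` /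
  `NSHopfGalerkinLimit`).
-/

open MeasureTheory Set Filter Topology UnitAddTorus
open scoped ENNReal NNReal InnerProductSpace ComplexConjugate

noncomputable section

namespace Literature.Barriers.AnomalousDissipation

open Literature.Analysis.FunctionSpaces Literature.Analysis.FunctionSpaces.Torus
open Literature.Analysis.FluidPDE Literature.Analysis.FluidPDE.Torus

/-- The flat two-torus `T² = (ℝ/ℤ)²` (local notation). -/
local notation "𝕋²" => UnitAddTorus (Fin 2)
/-- Velocity values on `T²` (local notation). -/
local notation "E²" => EuclideanSpace ℝ (Fin 2)
/-- Complexified velocity values (local notation). -/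
local notation "ℂ²" => EuclideanSpace ℂ (Fin 2)
/-- The frequency lattice `ℤ²` (local notation). -/
local notation "ℤ²" => Fin 2 → ℤ

/-! ### The frequency `e₀` and the Fourier coefficients of the force -/

section Force

/-- `e₀ 0 = 1`. [folklore] -/
@[simp] theorem firstModeFreq_apply_zero : firstModeFreq 0 = 1 := by
  simp [firstModeFreq]

/-- `e₀ 1 = 0`. [folklore] -/
@[simp] theorem firstModeFreq_apply_one : firstModeFreq 1 = 0 := by
  simp [firstModeFreq]

/-- `e₀ ≠ 0`. [folklore] -/
theorem firstModeFreq_ne_zero : firstModeFreq ≠ 0 := fun h => by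
  have := congrFun h 0
  simp at this

/-- `-e₀ ≠ 0`. [folklore] -/
theorem neg_firstModeFreq_ne_zero : -firstModeFreq ≠ 0 := fun h =>
  firstModeFreq_ne_zero (neg_eq_zero.1 h)

/-- `e₀ ≠ -e₀`. [folklore] -/
theorem firstModeFreq_ne_neg : firstModeFreq ≠ -firstModeFreq := fun h => by
  have := congrFun h 0
  simp at this

/-- `|e₀|² = 1`. [folklore] -/
theorem freqNormSq_firstModeFreq : freqNormSq firstModeFreq = 1 := by
  simp [freqNormSq, Fin.sum_univ_two]

/-- A frequency with non-zero second coordinate is neither `0` nor `±e₀`. [folklore] -/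
theorem ne_of_apply_one_ne_zero {k : ℤ²} (hk : k 1 ≠ 0) :
    k ≠ 0 ∧ k ≠ firstModeFreq ∧ k ≠ -firstModeFreq := by
  refine ⟨fun h => hk ?_, fun h => hk ?_, fun h => hk ?_⟩ <;> subst h <;> simp

/-- **The Fourier coefficients of the first-mode force** `f̂_α(k) = 𝓕(complexify ∘ f_α)(k)`. [folklore] -/
def marchioroForceCoeff (α : ℝ) (k : ℤ²) : ℂ² :=
  mFourierCoeff (EuclideanSpace.complexify ∘ marchioroForce α) k

/-- Explicit form: `f̂_α = ½ (𝟙[k = e₀] c + conj 𝟙[k = -e₀] c)`, `c = -iα√2 e₁`. [folklore] -/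
theorem marchioroForceCoeff_eq (α : ℝ) (k : ℤ²) :
    marchioroForceCoeff α k = (2 : ℂ)⁻¹ • ((if k = firstModeFreq then firstModeCoeff α else 0) +
      EuclideanSpace.conjVec (if k = -firstModeFreq then firstModeCoeff α else 0)) := by
  rw [marchioroForceCoeff, marchioroForce_eq_realTrigPoly, mFourierCoeff_realTrigPoly_singleton]

/-- The force has Fourier modes only at `±e₀`. [folklore] -/
theorem marchioroForceCoeff_eq_zero {α : ℝ} {k : ℤ²} (h1 : k ≠ firstModeFreq) (h2 : k ≠ -firstModeFreq) :
    marchioroForceCoeff α k = 0 := by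
  rw [marchioroForceCoeff_eq, if_neg h1, if_neg h2, EuclideanSpace.conjVec_zero, add_zero, smul_zero]

/-- The force has no mean mode. [folklore] -/
theorem marchioroForceCoeff_zero (α : ℝ) : marchioroForceCoeff α 0 = 0 :=
  marchioroForceCoeff_eq_zero firstModeFreq_ne_zero.symm neg_firstModeFreq_ne_zero.symm

/-- The first component of every Fourier coefficient of the force vanishes (the force points
along `e₁`). [folklore] -/
theorem marchioroForceCoeff_apply_zero (α : ℝ) (k : ℤ²) : marchioroForceCoeff α k 0 = 0 := by
  rw [marchioroForceCoeff_eq]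
  by_cases h1 : k = firstModeFreq
  · subst h1
    rw [if_pos rfl, if_neg firstModeFreq_ne_neg]
    simp [firstModeCoeff, EuclideanSpace.complexify_apply]
  · by_cases h2 : k = -firstModeFreq
    · rw [if_neg h1, if_pos h2]
      simp [firstModeCoeff, EuclideanSpace.complexify_apply, EuclideanSpace.conjVec_apply]
    · rw [if_neg h1, if_neg h2]
      simp

/-- The Fourier coefficients of the force vanish at frequencies with `k 1 ≠ 0`. [folklore] -/
theorem marchioroForceCoeff_eq_zero_of_apply_one_ne_zero (α : ℝ) {k : ℤ²} (hk : k 1 ≠ 0) :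
    marchioroForceCoeff α k = 0 :=
  marchioroForceCoeff_eq_zero (ne_of_apply_one_ne_zero hk).2.1 (ne_of_apply_one_ne_zero hk).2.2

/-- The Fourier coefficients of the force are transversal: `k · f̂_α(k) = 0`. [folklore] -/
theorem sum_mul_marchioroForceCoeff (α : ℝ) (k : ℤ²) : ∑ j, (k j : ℂ) * marchioroForceCoeff α k j = 0 := by
  rw [Fin.sum_univ_two, marchioroForceCoeff_apply_zero, mul_zero, zero_add]
  by_cases hk : k 1 = 0
  · rw [hk, Int.cast_zero, zero_mul]
  · rw [marchioroForceCoeff_eq_zero_of_apply_one_ne_zero α hk, PiLp.zero_apply, mul_zero]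

/-- The Fourier coefficients of the (real) force are conjugate symmetric. [folklore] -/
theorem isConjSymm_marchioroForceCoeff (α : ℝ) : IsConjSymm (marchioroForceCoeff α) :=
  isConjSymm_mFourierCoeff (isSmooth_marchioroForce α).integrable

/-- Bessel for the force on a finite set of frequencies: `∑_{k ∈ S} ‖f̂_α(k)‖² ≤ 2α²`
(`‖f_α(x)‖ ≤ |α|√2` pointwise). [folklore] -/
theorem sum_norm_sq_marchioroForceCoeff_le (α : ℝ) (S : Finset ℤ²) :
    ∑ k ∈ S, ‖marchioroForceCoeff α k‖ ^ 2 ≤ 2 * α ^ 2 := by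
  have h1 : ∑ k ∈ S, ‖marchioroForceCoeff α k‖ ^ 2 ≤ ∫ x, ‖marchioroForce α x‖ ^ 2 :=
    sum_sq_norm_mFourierCoeff_le_integral ((isSmooth_marchioroForce α).memLp 2) S
  have h2 : ∫ x, ‖marchioroForce α x‖ ^ 2 ≤ ‖firstModeCoeff α‖ ^ 2 := by
    rw [marchioroForce_eq_realTrigPoly]
    exact integral_norm_sq_realTrigPoly_singleton_le _ _
  have h3 : ‖firstModeCoeff α‖ ^ 2 = 2 * α ^ 2 := by
    rw [firstModeCoeff, norm_smul, norm_neg, Complex.norm_I, one_mul,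
      EuclideanSpace.norm_complexify, norm_smul, PiLp.norm_single, norm_one, mul_one,
      Real.norm_eq_abs, abs_mul, abs_of_nonneg (Real.sqrt_nonneg 2), mul_pow, sq_abs,
      Real.sq_sqrt zero_le_two]
    ring
  linarith

end Force

/-! ### The sweep rates `Λ_k = 4π²ν|k|² + 2πi (m·k)` -/

section Rate

/-- **The sweep rate** at frequency `k` for viscosity `ν` and mean momentum `m`:
`Λ_k = 4π²ν|k|² + 2πi ∑ⱼ mⱼ kⱼ` — Stokes damping plus the Doppler shift of the mode `e_k` seen
by a fluid translating with velocity `m` (FMRT 2001, Ch. II (2.9)). [cite: FoiasManleyRosaTemam2001, Ch. II (2.6)–(2.9)] -/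
def sweepRate (ν : ℝ) (m : E²) (k : ℤ²) : ℂ :=
  ((ν * (4 * Real.pi ^ 2 * freqNormSq k) : ℝ) : ℂ) +
    2 * Real.pi * Complex.I * ∑ j, EuclideanSpace.complexify m j * (k j : ℂ)

/-- The Doppler sum `∑ⱼ mⱼ kⱼ` is real. [folklore] -/
theorem sum_complexify_mul_eq_ofReal (m : E²) (k : ℤ²) :
    ∑ j, EuclideanSpace.complexify m j * (k j : ℂ) = ((∑ j, m j * (k j : ℝ) : ℝ) : ℂ) := by
  push_cast
  simp [EuclideanSpace.complexify_apply]

/-- Real part of the sweep rate: `Re Λ_k = 4π²ν|k|²`. [folklore] -/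
theorem re_sweepRate (ν : ℝ) (m : E²) (k : ℤ²) :
    (sweepRate ν m k).re = ν * (4 * Real.pi ^ 2 * freqNormSq k) := by
  rw [sweepRate, sum_complexify_mul_eq_ofReal, Complex.add_re, Complex.ofReal_re,
    Complex.re_mul_ofReal]
  simp [Complex.mul_re, Complex.mul_im]

/-- Imaginary part of the sweep rate: `Im Λ_k = 2π ∑ⱼ mⱼ kⱼ`. [folklore] -/
theorem im_sweepRate (ν : ℝ) (m : E²) (k : ℤ²) :
    (sweepRate ν m k).im = 2 * Real.pi * ∑ j, m j * (k j : ℝ) := by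
  rw [sweepRate, sum_complexify_mul_eq_ofReal, Complex.add_im, Complex.ofReal_im,
    Complex.im_mul_ofReal]
  simp [Complex.mul_re, Complex.mul_im]

/-- The sweep rate at `-k` is the conjugate of the sweep rate at `k`. [folklore] -/
theorem sweepRate_neg (ν : ℝ) (m : E²) (k : ℤ²) :
    sweepRate ν m (-k) = conj (sweepRate ν m k) := by
  apply Complex.ext
  · rw [re_sweepRate, Complex.conj_re, re_sweepRate, freqNormSq_neg]
  · rw [im_sweepRate, Complex.conj_im, im_sweepRate, ← mul_neg, ← Finset.sum_neg_distrib]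
    refine congrArg _ (Finset.sum_congr rfl fun j _ => ?_)
    simp

/-- For `ν > 0` and `k ≠ 0` the sweep rate has positive real part. [folklore] -/
theorem re_sweepRate_pos {ν : ℝ} (hν : 0 < ν) (m : E²) {k : ℤ²} (hk : k ≠ 0) :
    0 < (sweepRate ν m k).re := by
  rw [re_sweepRate]
  have h1 : 0 < freqNormSq k := by
    rcases (freqNormSq_nonneg k).lt_or_eq with h | h
    · exact h
    · exact absurd ((freqNormSq_eq_zero_iff k).1 h.symm) hk
  positivity

/-- For `ν ≥ 0` the sweep rate has non-negative real part. [folklore] -/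
theorem re_sweepRate_nonneg {ν : ℝ} (hν : 0 ≤ ν) (m : E²) (k : ℤ²) :
    0 ≤ (sweepRate ν m k).re := by
  rw [re_sweepRate]
  have := freqNormSq_nonneg k
  positivity

/-- For `ν > 0` and `k ≠ 0` the sweep rate is non-zero. [folklore] -/
theorem sweepRate_ne_zero {ν : ℝ} (hν : 0 < ν) (m : E²) {k : ℤ²} (hk : k ≠ 0) :
    sweepRate ν m k ≠ 0 := fun h => by
  have := re_sweepRate_pos hν m hk
  rw [h, Complex.zero_re] at this
  exact lt_irrefl _ this

/-- The sweep rate at `e₀` dominates the Doppler shift: `2π |m₀| ≤ |Λ_{e₀}|`. [folklore] -/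
theorem two_pi_mul_abs_le_norm_sweepRate (ν : ℝ) (m : E²) :
    2 * Real.pi * |m 0| ≤ ‖sweepRate ν m firstModeFreq‖ := by
  have h := Complex.abs_im_le_norm (sweepRate ν m firstModeFreq)
  rw [im_sweepRate] at h
  simp only [Fin.sum_univ_two, firstModeFreq_apply_zero, firstModeFreq_apply_one, Int.cast_one,
    mul_one, Int.cast_zero, mul_zero, add_zero] at h
  rwa [abs_mul, abs_of_pos Real.two_pi_pos] at h

/-- The relaxation factor is bounded: `|1 - e^{-Λt}| ≤ 2` for `Re Λ ≥ 0`, `t ≥ 0`. [folklore] -/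
theorem norm_one_sub_exp_le {Λ : ℂ} (hΛ : 0 ≤ Λ.re) {t : ℝ} (ht : 0 ≤ t) :
    ‖1 - Complex.exp (-(Λ * t))‖ ≤ 2 := by
  have h1 : ‖Complex.exp (-(Λ * t))‖ ≤ 1 := by
    rw [Complex.norm_exp]
    refine Real.exp_le_one_iff.2 ?_
    simp only [Complex.neg_re, Complex.mul_re, Complex.ofReal_re, Complex.ofReal_im, mul_zero,
      sub_zero, Left.neg_nonpos_iff]
    exact mul_nonneg hΛ ht
  calc ‖1 - Complex.exp (-(Λ * t))‖ ≤ ‖(1 : ℂ)‖ + ‖Complex.exp (-(Λ * t))‖ := norm_sub_le _ _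
    _ ≤ 1 + 1 := by rw [norm_one]; gcongr
    _ = 2 := by norm_num

end Rate

/-! ### The Fourier coefficients of the swept state -/

section Coeff

/-- The relaxation factor `ρ_k(t) = (1 - e^{-Λ_k t}) / Λ_k` (solution of `ρ' = -Λ_k ρ + 1`,
`ρ(0) = 0`). [folklore] -/
def sweepFactor (ν : ℝ) (m : E²) (t : ℝ) (k : ℤ²) : ℂ :=
  (1 - Complex.exp (-(sweepRate ν m k * t))) / sweepRate ν m k

/-- **The Fourier coefficients of the swept state**: the mean mode carries the momentum `m`,
every other mode relaxes towards the Doppler-detuned response `f̂_α(k)/Λ_k`: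
`ĉ(t)(0) = m`, `ĉ(t)(k) = ρ_k(t) f̂_α(k)` (`k ≠ 0`; non-zero only for `k = ±e₀`). [folklore] -/
def sweptCoeff (α ν : ℝ) (m : E²) (t : ℝ) (k : ℤ²) : ℂ² :=
  if k = 0 then EuclideanSpace.complexify m else sweepFactor ν m t k • marchioroForceCoeff α k

variable {α ν : ℝ} {m : E²}

/-- The mean mode of the swept state is the momentum `m`. [folklore] -/
theorem sweptCoeff_zero_freq (α ν : ℝ) (m : E²) (t : ℝ) :
    sweptCoeff α ν m t 0 = EuclideanSpace.complexify m :=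
  if_pos rfl

/-- The non-zero modes of the swept state. [folklore] -/
theorem sweptCoeff_of_ne_zero (α ν : ℝ) (m : E²) (t : ℝ) {k : ℤ²} (hk : k ≠ 0) :
    sweptCoeff α ν m t k = sweepFactor ν m t k • marchioroForceCoeff α k :=
  if_neg hk

/-- The swept state has Fourier modes only at `0` and `±e₀`. [folklore] -/
theorem sweptCoeff_eq_zero (t : ℝ) {k : ℤ²} (h0 : k ≠ 0) (h1 : k ≠ firstModeFreq)
    (h2 : k ≠ -firstModeFreq) : sweptCoeff α ν m t k = 0 := by
  rw [sweptCoeff_of_ne_zero α ν m t h0, marchioroForceCoeff_eq_zero h1 h2, smul_zero]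

/-- The swept state has no Fourier modes at frequencies with `k 1 ≠ 0`. [folklore] -/
theorem sweptCoeff_eq_zero_of_apply_one_ne_zero (t : ℝ) {k : ℤ²} (hk : k 1 ≠ 0) :
    sweptCoeff α ν m t k = 0 :=
  sweptCoeff_eq_zero t (ne_of_apply_one_ne_zero hk).1 (ne_of_apply_one_ne_zero hk).2.1
    (ne_of_apply_one_ne_zero hk).2.2

/-- Off the frequency ball `|k|² ≤ 1` the swept coefficients vanish. [folklore] -/
theorem sweptCoeff_eq_zero_of_not_mem_freqBall (t : ℝ) {k : ℤ²} (hk : k ∉ freqBall 1) :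
    sweptCoeff α ν m t k = 0 := by
  rw [not_mem_freqBall, Nat.cast_one, one_pow] at hk
  refine sweptCoeff_eq_zero t ?_ ?_ ?_
  · rintro rfl
    have h0 : freqNormSq (0 : ℤ²) = 0 := by simp [freqNormSq]
    rw [h0] at hk
    norm_num at hk
  · rintro rfl
    rw [freqNormSq_firstModeFreq] at hk
    exact lt_irrefl _ hk
  · rintro rfl
    rw [freqNormSq_neg, freqNormSq_firstModeFreq] at hk
    exact lt_irrefl _ hk

/-- The first component of every non-zero mode of the swept state vanishes. [folklore] -/
theorem sweptCoeff_apply_zero_of_ne_zero (t : ℝ) {k : ℤ²} (hk : k ≠ 0) :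
    sweptCoeff α ν m t k 0 = 0 := by
  rw [sweptCoeff_of_ne_zero α ν m t hk, PiLp.smul_apply, marchioroForceCoeff_apply_zero, smul_zero]

/-- The swept coefficients are transversal: `k · ĉ(t)(k) = 0` (the swept state is divergence
free). [folklore] -/
theorem sum_mul_sweptCoeff (α ν : ℝ) (m : E²) (t : ℝ) (k : ℤ²) :
    ∑ j, (k j : ℂ) * sweptCoeff α ν m t k j = 0 := by
  by_cases hk : k = 0
  · subst hk
    simp
  · rw [sweptCoeff_of_ne_zero α ν m t hk]
    simp only [PiLp.smul_apply, smul_eq_mul, mul_left_comm _ (sweepFactor ν m t k)]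
    rw [← Finset.mul_sum, sum_mul_marchioroForceCoeff, mul_zero]

/-- The relaxation factor at `-k` is the conjugate of the one at `k`. [folklore] -/
theorem sweepFactor_neg (ν : ℝ) (m : E²) (t : ℝ) (k : ℤ²) :
    sweepFactor ν m t (-k) = conj (sweepFactor ν m t k) := by
  rw [sweepFactor, sweepFactor, sweepRate_neg, map_div₀, map_sub, map_one, ← Complex.exp_conj,
    map_neg, map_mul, Complex.conj_ofReal]

/-- The swept coefficients are conjugate symmetric (the swept state is real). [folklore] -/
theorem isConjSymm_sweptCoeff (α ν : ℝ) (m : E²) (t : ℝ) : IsConjSymm (sweptCoeff α ν m t) := by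
  intro k
  by_cases hk : k = 0
  · subst hk
    rw [neg_zero, sweptCoeff_zero_freq, EuclideanSpace.conjVec_complexify]
  · rw [sweptCoeff_of_ne_zero α ν m t (neg_ne_zero.2 hk), sweptCoeff_of_ne_zero α ν m t hk,
      sweepFactor_neg, isConjSymm_marchioroForceCoeff α k, EuclideanSpace.conjVec_smul]

/-- At time `0` the relaxation factor vanishes. [folklore] -/
theorem sweepFactor_time_zero (ν : ℝ) (m : E²) (k : ℤ²) : sweepFactor ν m 0 k = 0 := by
  simp [sweepFactor]

/-- At time `0` the swept state is the constant field `m`: only the mean mode is present. [folklore] -/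
theorem sweptCoeff_time_zero (α ν : ℝ) (m : E²) (k : ℤ²) :
    sweptCoeff α ν m 0 k = if k = 0 then EuclideanSpace.complexify m else 0 := by
  by_cases hk : k = 0
  · rw [if_pos hk, hk, sweptCoeff_zero_freq]
  · rw [if_neg hk, sweptCoeff_of_ne_zero α ν m 0 hk, sweepFactor_time_zero, zero_smul]

/-- **The detuning bound**: for `t ≥ 0`, `ν ≥ 0` and a momentum with `m₀ ≠ 0`, every non-zero
mode of the swept state is bounded by `‖f̂_α(k)‖/(π|m₀|)`, uniformly in `ν`
(`|1 - e^{-Λt}| ≤ 2`, `|Λ_{±e₀}| ≥ 2π|m₀|`). [folklore] -/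
theorem norm_sweptCoeff_le (hν : 0 ≤ ν) (hm : m 0 ≠ 0) {t : ℝ} (ht : 0 ≤ t) {k : ℤ²}
    (hk : k ≠ 0) : ‖sweptCoeff α ν m t k‖ ≤ (Real.pi * |m 0|)⁻¹ * ‖marchioroForceCoeff α k‖ := by
  have hπm : 0 < Real.pi * |m 0| := mul_pos Real.pi_pos (abs_pos.2 hm)
  by_cases hF : k = firstModeFreq ∨ k = -firstModeFreq
  · -- the two modes of the force: `‖ρ‖ ≤ 2 / (2π|m₀|)`
    have hΛ : 2 * Real.pi * |m 0| ≤ ‖sweepRate ν m k‖ := by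
      rcases hF with rfl | rfl
      · exact two_pi_mul_abs_le_norm_sweepRate ν m
      · rw [sweepRate_neg, Complex.norm_conj]
        exact two_pi_mul_abs_le_norm_sweepRate ν m
    rw [sweptCoeff_of_ne_zero α ν m t hk, norm_smul]
    refine mul_le_mul_of_nonneg_right ?_ (norm_nonneg _)
    rw [sweepFactor, norm_div]
    calc ‖1 - Complex.exp (-(sweepRate ν m k * t))‖ / ‖sweepRate ν m k‖
        ≤ 2 / (2 * Real.pi * |m 0|) :=
          div_le_div₀ zero_le_two (norm_one_sub_exp_le (re_sweepRate_nonneg hν m k) ht)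
            (by positivity) hΛ
      _ = (Real.pi * |m 0|)⁻¹ := by
          field_simp
  · -- elsewhere the force, hence the coefficient, vanishes
    push Not at hF
    rw [sweptCoeff_of_ne_zero α ν m t hk, marchioroForceCoeff_eq_zero hF.1 hF.2, smul_zero, norm_zero,
      mul_zero]

end Coeff

/-! ### The Galerkin equations along the swept coefficients -/

section Galerkin

variable {α ν : ℝ} {m : E²}

/-- The coefficient family of the constant field `m` (the mean mode alone). [folklore] -/
def momentumCoeff (m : E²) (k : ℤ²) : ℂ² :=
  if k = 0 then EuclideanSpace.complexify m else 0

/-- **Advection by the mean flow in Fourier variables**: convecting with the constant field `m`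
multiplies the mode `k` by the Doppler factor `2πi (m·k)`. [folklore] -/
theorem convectionCoeff_momentumCoeff_left {S : Finset ℤ²} (h0 : (0 : ℤ²) ∈ S) {k : ℤ²} (hk : k ∈ S)
    (c' : ℤ² → ℂ²) :
    convectionCoeff S (momentumCoeff m) c' k =
      (2 * Real.pi * Complex.I * ∑ j, EuclideanSpace.complexify m j * (k j : ℂ)) • c' k := by
  rw [convectionCoeff_def, Finset.sum_eq_single_of_mem (0 : ℤ²) h0]
  · simp_rw [zero_add, momentumCoeff, if_true]
    rw [Finset.sum_ite_eq' S k, if_pos hk]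
  · intro l _ hl0
    refine Finset.sum_eq_zero fun m' _ => ?_
    rw [momentumCoeff, if_neg hl0]
    simp

/-- On `𝕋²`, a family whose first components vanish does not convect a family supported on
frequencies with vanishing second coordinate: every entry `(b_l · m') c'_{m'}` of the convection
symbol is `b_{l,0} m'₀ + b_{l,1} m'₁ = 0` when `c'_{m'} ≠ 0`. [folklore] -/
theorem convectionCoeff_eq_zero_of_apply {S : Finset ℤ²} {b c' : ℤ² → ℂ²} (hb : ∀ l, b l 0 = 0)
    (hc' : ∀ m', m' 1 ≠ 0 → c' m' = 0) (k : ℤ²) : convectionCoeff S b c' k = 0 := by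
  rw [convectionCoeff_def]
  refine Finset.sum_eq_zero fun l _ => Finset.sum_eq_zero fun m' _ => ?_
  split_ifs with h
  · by_cases hm1 : m' 1 = 0
    · have h0 : ∑ j, b l j * (m' j : ℂ) = 0 := by
        rw [Fin.sum_univ_two, hb l, hm1, Int.cast_zero, mul_zero, zero_mul, add_zero]
      rw [h0, mul_zero, zero_smul]
    · rw [hc' m' hm1, smul_zero]
  · rfl

/-- The swept coefficients split into the mean mode and the first-shell part. [folklore] -/
theorem sweptCoeff_eq_momentumCoeff_add (α ν : ℝ) (m : E²) (t : ℝ) :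
    sweptCoeff α ν m t = momentumCoeff m + fun k => if k = 0 then 0 else sweptCoeff α ν m t k := by
  funext k
  by_cases hk : k = 0
  · subst hk
    simp [momentumCoeff, sweptCoeff_zero_freq]
  · simp [momentumCoeff, hk]

/-- **The nonlinear term along the swept state is pure sweeping**: for `0, k ∈ S`,
`𝓕[(u·∇)u](k) = 2πi (m·k) ĉ(k)` — the first-shell part does not convect itself or the mean
(`(U e₁·∇)(U(x₀) e₁) = 0`), only the mean flow advects the shell. [folklore] -/
theorem convectionCoeff_sweptCoeff {S : Finset ℤ²} (h0 : (0 : ℤ²) ∈ S) {k : ℤ²} (hk : k ∈ S)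
    (t : ℝ) :
    convectionCoeff S (sweptCoeff α ν m t) (sweptCoeff α ν m t) k =
      (2 * Real.pi * Complex.I * ∑ j, EuclideanSpace.complexify m j * (k j : ℂ)) •
        sweptCoeff α ν m t k := by
  have hsplit := sweptCoeff_eq_momentumCoeff_add α ν m t
  have hadd := convectionCoeff_add_left S (momentumCoeff m)
    (fun k => if k = 0 then 0 else sweptCoeff α ν m t k) (sweptCoeff α ν m t) k
  rw [← hsplit] at hadd
  rw [hadd, convectionCoeff_momentumCoeff_left h0 hk,
    convectionCoeff_eq_zero_of_apply (fun l => ?_) (fun m' hm' => ?_) k, add_zero]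
  · by_cases hl : l = 0
    · simp [hl]
    · simp only [if_neg hl]
      exact sweptCoeff_apply_zero_of_ne_zero t hl
  · exact sweptCoeff_eq_zero_of_apply_one_ne_zero t hm'

/-- The time derivative of the swept coefficients: `0` on the mean mode, `e^{-Λ_k t} f̂_α(k)`
elsewhere. [folklore] -/
def sweptCoeffDeriv (α ν : ℝ) (m : E²) (t : ℝ) (k : ℤ²) : ℂ² :=
  if k = 0 then 0 else Complex.exp (-(sweepRate ν m k * t)) • marchioroForceCoeff α k

/-- **The swept coefficients solve the Galerkin system** driven by the exact force, on every
frequency set containing `0` and the frequency in question: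
`V(f̂_α, ĉ(t))(k) = d/dt ĉ(t)(k)` — on the mean mode everything vanishes (no mean force, no
mean output of the sweeping term), and on `k ≠ 0` the Stokes term and the sweeping term combine
into `-Λ_k ĉ(k)`, the Leray symbol acting as the identity on the transversal vector
`f̂_α(k) - 2πi(m·k) ĉ(k)`. [folklore] -/
theorem galerkinField_sweptCoeff (hν : 0 < ν) {S : Finset ℤ²} (h0 : (0 : ℤ²) ∈ S) {k : ℤ²}
    (hk : k ∈ S) (t : ℝ) :
    galerkinField ν S (marchioroForceCoeff α) (sweptCoeff α ν m t) k = sweptCoeffDeriv α ν m t k := by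
  rw [galerkinField_def, convectionCoeff_sweptCoeff h0 hk t]
  by_cases hk0 : k = 0
  · subst hk0
    have hs : ∑ j, EuclideanSpace.complexify m j * ((0 : ℤ²) j : ℂ) = 0 := by simp
    rw [hs, mul_zero, zero_smul, sub_zero, marchioroForceCoeff_zero, leraySym_zero, add_zero,
      sweptCoeffDeriv, if_pos rfl]
    have h00 : freqNormSq (0 : ℤ²) = 0 := by simp [freqNormSq]
    rw [h00, mul_zero, mul_zero, Complex.ofReal_zero, zero_smul, neg_zero]
  · -- `k ≠ 0`: the Leray symbol is the identity on the (transversal) bracket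
    set σ : ℂ := 2 * Real.pi * Complex.I * ∑ j, EuclideanSpace.complexify m j * (k j : ℂ) with hσ
    have htrans : ∑ i, (k i : ℂ) * (marchioroForceCoeff α k - σ • sweptCoeff α ν m t k) i = 0 := by
      have h1 := sum_mul_marchioroForceCoeff α k
      have h2 := sum_mul_sweptCoeff α ν m t k
      have h3 : ∑ i, (k i : ℂ) * (σ * sweptCoeff α ν m t k i) =
          σ * ∑ i, (k i : ℂ) * sweptCoeff α ν m t k i := by
        rw [Finset.mul_sum]
        exact Finset.sum_congr rfl fun i _ => by ring
      simp only [PiLp.sub_apply, PiLp.smul_apply, smul_eq_mul, mul_sub, Finset.sum_sub_distrib,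
        h1, h3, h2, mul_zero, sub_zero]
    rw [leraySym_of_transversal htrans, sweptCoeffDeriv, if_neg hk0,
      sweptCoeff_of_ne_zero α ν m t hk0]
    set ρ : ℂ := sweepFactor ν m t k with hρ
    set F : ℂ² := marchioroForceCoeff α k with hF
    set cνl : ℂ := ((ν * (4 * Real.pi ^ 2 * freqNormSq k) : ℝ) : ℂ) with hcνl
    have hΛ : sweepRate ν m k ≠ 0 := sweepRate_ne_zero hν m hk0
    have hsplit : cνl = sweepRate ν m k - σ := by
      rw [hcνl, hσ, sweepRate]
      ring
    have hvec : -(cνl • (ρ • F)) + (F - σ • (ρ • F)) = (-(cνl * ρ) + (1 - σ * ρ)) • F := by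
      simp only [smul_smul, add_smul, sub_smul, neg_smul, one_smul]
    rw [hvec]
    congr 1
    rw [hsplit, hρ, sweepFactor]
    field_simp
    ring

end Galerkin

/-! ### Time regularity of the swept coefficients -/

section Time

variable {α ν : ℝ} {m : E²}

/-- The relaxation factor solves `ρ' = e^{-Λt}` (`= -Λρ + 1`). [folklore] -/
theorem hasDerivAt_sweepFactor (hν : 0 < ν) (m : E²) {k : ℤ²} (hk : k ≠ 0) (t : ℝ) :
    HasDerivAt (fun s : ℝ => sweepFactor ν m s k) (Complex.exp (-(sweepRate ν m k * t))) t := by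
  set Λ : ℂ := sweepRate ν m k with hΛdef
  have hΛ : Λ ≠ 0 := sweepRate_ne_zero hν m hk
  have h1 : HasDerivAt (fun s : ℝ => -(Λ * (s : ℂ))) (-Λ) t := by
    have h : HasDerivAt (fun s : ℝ => -Λ * ((id s : ℝ) : ℂ)) (-Λ * ((1 : ℝ) : ℂ)) t :=
      (hasDerivAt_id t).ofReal_comp.const_mul (-Λ)
    simp only [id, Complex.ofReal_one, mul_one] at h
    exact h.congr_of_eventuallyEq (Eventually.of_forall fun s => by simp [neg_mul])
  have h2 : HasDerivAt (fun s : ℝ => Complex.exp (-(Λ * (s : ℂ))))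
      (Complex.exp (-(Λ * (t : ℂ))) * -Λ) t :=
    (Complex.hasDerivAt_exp _).comp t h1
  have h3 := (h2.const_sub 1).div_const Λ
  refine h3.congr_deriv ?_
  field_simp

/-- **The swept coefficients are differentiable in time** with derivative `sweptCoeffDeriv`. [folklore] -/
theorem hasDerivAt_sweptCoeff (hν : 0 < ν) (k : ℤ²) (t : ℝ) :
    HasDerivAt (fun s : ℝ => sweptCoeff α ν m s k) (sweptCoeffDeriv α ν m t k) t := by
  by_cases hk : k = 0
  · subst hk
    simp only [sweptCoeff_zero_freq, sweptCoeffDeriv, if_true]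
    exact hasDerivAt_const t _
  · have hfun : (fun s : ℝ => sweptCoeff α ν m s k) = fun s => sweepFactor ν m s k • marchioroForceCoeff α k :=
      funext fun s => sweptCoeff_of_ne_zero α ν m s hk
    rw [hfun, sweptCoeffDeriv, if_neg hk]
    exact (hasDerivAt_sweepFactor hν m hk t).smul_const _

/-- The swept coefficients are continuous in time. [folklore] -/
theorem continuous_sweptCoeff (hν : 0 < ν) (k : ℤ²) :
    Continuous fun s : ℝ => sweptCoeff α ν m s k :=
  continuous_iff_continuousAt.2 fun t => (hasDerivAt_sweptCoeff hν k t).continuousAt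

end Time

/-! ### The swept state: definition, Fourier coefficients, energy -/

section State

variable {α ν : ℝ} {m : E²}

/-- **The Galilean swept state** with momentum `m` under the first-mode force `f_α` at
viscosity `ν`: `u(t) = Re ∑_{|k|² ≤ 1} ĉ(t)(k) e_k = m + Re (2ĉ(t)(e₀) e^{2πix₀})`, i.e.
`m + (a(t) sin 2πx₀ + b(t) cos 2πx₀) e₁` with `a + ib = z*(1 - e^{-(4π²ν + 2πim₀)t})`,
`z* = α√2/(4π²ν + 2πim₀)` — the exact solution of the 2-D Navier–Stokes equations on `𝕋²` with
force `f_α`, zero pressure and constant datum `u(0) ≡ m` (FMRT 2001, Ch. II (2.6)–(2.9): the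
Galilean image of the response to the moving force `f_α(x + mt)`); its `t → ∞` limit is the
steady drifting laminar state `marchioroDriftState α ν m` of the parent file
(`z* = driftSinCoeff + i driftCosCoeff`). [cite: FoiasManleyRosaTemam2001, Ch. II (2.6)–(2.9)] -/
def marchioroSweptState (α ν : ℝ) (m : E²) (t : ℝ) : 𝕋² → E² :=
  realTrigPoly (freqBall 1) (sweptCoeff α ν m t)

/-- The frequency ball `|k|² ≤ 1` is symmetric. [folklore] -/
theorem neg_mem_freqBall_one : ∀ k ∈ freqBall (d := Fin 2) 1, -k ∈ freqBall (d := Fin 2) 1 :=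
  neg_mem_freqBall_of_mem

/-- Unfolding `marchioroSweptState`. [folklore] -/
theorem marchioroSweptState_eq (α ν : ℝ) (m : E²) (t : ℝ) :
    marchioroSweptState α ν m t = realTrigPoly (freqBall 1) (sweptCoeff α ν m t) :=
  rfl

/-- **The Fourier coefficients of the swept state are the swept coefficients.** [folklore] -/
theorem mFourierCoeff_marchioroSweptState (α ν : ℝ) (m : E²) (t : ℝ) (k : ℤ²) :
    mFourierCoeff (EuclideanSpace.complexify ∘ marchioroSweptState α ν m t) k = sweptCoeff α ν m t k := by
  rw [marchioroSweptState, mFourierCoeff_realTrigPoly neg_mem_freqBall_one (isConjSymm_sweptCoeff α ν m t)]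
  split_ifs with hk
  · rfl
  · exact (sweptCoeff_eq_zero_of_not_mem_freqBall t hk).symm

/-- **The datum of the swept state is the constant field `m`.** [folklore] -/
theorem marchioroSweptState_zero (α ν : ℝ) (m : E²) : marchioroSweptState α ν m 0 = fun _ => m := by
  have h1 : marchioroSweptState α ν m 0 = realTrigPoly {(0 : ℤ²)} (sweptCoeff α ν m 0) := by
    rw [marchioroSweptState, realTrigPoly_eq_comp, realTrigPoly_eq_comp,
      trigPoly_subset (Finset.singleton_subset_iff.2 (zero_mem_freqBall 1)) fun k _ hk => ?_]
    rw [Finset.mem_singleton] at hk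
    rw [sweptCoeff_time_zero, if_neg hk]
  funext x
  rw [h1, realTrigPoly_singleton_apply, mFourier_zero, sweptCoeff_zero_freq]
  simp [EuclideanSpace.realPart_complexify]

/-- The swept state is smooth in space. [folklore] -/
theorem isSmooth_marchioroSweptState (α ν : ℝ) (m : E²) (t : ℝ) :
    IsSmooth (marchioroSweptState α ν m t) :=
  isSmooth_realTrigPoly _ _

/-- The swept state is (classically) divergence free. [folklore] -/
theorem isDivFree_marchioroSweptState (α ν : ℝ) (m : E²) (t : ℝ) :
    IsDivFree (marchioroSweptState α ν m t) :=
  isDivFree_realTrigPoly fun k _ => sum_mul_sweptCoeff α ν m t k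

/-- The swept state is square integrable. [folklore] -/
theorem memLp_marchioroSweptState (α ν : ℝ) (m : E²) (t : ℝ) (p : ℝ≥0∞) :
    MemLp (marchioroSweptState α ν m t) p volume :=
  memLp_realTrigPoly _ _ p

/-- **Energy of the swept state (finite Parseval)**: `∫ ‖u(t)‖² = ∑_{|k|² ≤ 1} ‖ĉ(t)(k)‖²`. [folklore] -/
theorem integral_norm_sq_marchioroSweptState (α ν : ℝ) (m : E²) (t : ℝ) :
    ∫ x, ‖marchioroSweptState α ν m t x‖ ^ 2 = ∑ k ∈ freqBall 1, ‖sweptCoeff α ν m t k‖ ^ 2 :=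
  integral_norm_sq_realTrigPoly neg_mem_freqBall_one (isConjSymm_sweptCoeff α ν m t)

/-- **The detuned shell**: for `ν ≥ 0`, `t ≥ 0` and `m₀ = m 0 ≠ 0`, the non-zero modes of
the swept state carry energy at most `2α²/(π² m₀²)`, uniformly in `ν`. [folklore] -/
theorem sum_erase_norm_sq_sweptCoeff_le (hν : 0 ≤ ν) (hm : m 0 ≠ 0) {t : ℝ} (ht : 0 ≤ t) :
    ∑ k ∈ (freqBall 1).erase 0, ‖sweptCoeff α ν m t k‖ ^ 2 ≤ 2 * α ^ 2 / (Real.pi ^ 2 * (m 0) ^ 2) := by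
  have hπm : 0 < Real.pi * |m 0| := mul_pos Real.pi_pos (abs_pos.2 hm)
  calc ∑ k ∈ (freqBall 1).erase 0, ‖sweptCoeff α ν m t k‖ ^ 2
      ≤ ∑ k ∈ (freqBall 1).erase 0, ((Real.pi * |m 0|)⁻¹ * ‖marchioroForceCoeff α k‖) ^ 2 :=
        Finset.sum_le_sum fun k hk =>
          pow_le_pow_left₀ (norm_nonneg _)
            (norm_sweptCoeff_le hν hm ht (Finset.ne_of_mem_erase hk)) 2
    _ = (Real.pi * |m 0|)⁻¹ ^ 2 * ∑ k ∈ (freqBall 1).erase 0, ‖marchioroForceCoeff α k‖ ^ 2 := by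
        rw [Finset.mul_sum]
        exact Finset.sum_congr rfl fun k _ => by ring
    _ ≤ (Real.pi * |m 0|)⁻¹ ^ 2 * (2 * α ^ 2) := by
        gcongr
        exact sum_norm_sq_marchioroForceCoeff_le α _
    _ = 2 * α ^ 2 / (Real.pi ^ 2 * (m 0) ^ 2) := by
        rw [inv_pow, mul_pow, sq_abs]
        field_simp

/-- **The uniform-in-viscosity energy bound** (the detuning): for `ν ≥ 0`, `t ≥ 0` and a
momentum with `m₀ = m 0 ≠ 0`,
`∫ ‖u(t)‖² ≤ ‖m‖² + 2α²/(π² m₀²)` — independently of `ν` (contrast the laminar state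
`f_α/(4π²ν)`, whose energy `α²/(16π⁴ν²)` blows up as `ν → 0`). [folklore] -/
theorem integral_norm_sq_marchioroSweptState_le (hν : 0 ≤ ν) (hm : m 0 ≠ 0) {t : ℝ} (ht : 0 ≤ t) :
    ∫ x, ‖marchioroSweptState α ν m t x‖ ^ 2 ≤ ‖m‖ ^ 2 + 2 * α ^ 2 / (Real.pi ^ 2 * (m 0) ^ 2) := by
  rw [integral_norm_sq_marchioroSweptState, ← Finset.add_sum_erase _ _ (zero_mem_freqBall 1),
    sweptCoeff_zero_freq, EuclideanSpace.norm_complexify]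
  gcongr
  exact sum_erase_norm_sq_sweptCoeff_le hν hm ht

/-- **The dissipation of the swept state is `O(ν)`**: `‖∇u(t)‖₂² ≤ 8α²/m₀²` for `t ≥ 0`,
uniformly in `ν ≥ 0` (`‖∇u‖² = 4π² ∑_{|k| = 1} ‖ĉ(k)‖²`), so `ν‖∇u(t)‖² ≤ 8να²/m₀² → 0`: the
Galilean evasion of the energy consequence does **not** produce anomalous dissipation. [folklore] -/
theorem toReal_eGradNormSq_marchioroSweptState_le (hν : 0 ≤ ν) (hm : m 0 ≠ 0) {t : ℝ} (ht : 0 ≤ t) :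
    (eGradNormSq (marchioroSweptState α ν m t)).toReal ≤ 8 * α ^ 2 / (m 0) ^ 2 := by
  have hsum0 : 0 ≤ ∑ k ∈ freqBall 1, freqNormSq k * ‖sweptCoeff α ν m t k‖ ^ 2 :=
    Finset.sum_nonneg fun k _ => mul_nonneg (freqNormSq_nonneg k) (sq_nonneg _)
  rw [marchioroSweptState_eq, eGradNormSq_realTrigPoly neg_mem_freqBall_one (isConjSymm_sweptCoeff α ν m t),
    ENNReal.toReal_ofReal (by positivity)]
  have h1 : ∑ k ∈ freqBall 1, freqNormSq k * ‖sweptCoeff α ν m t k‖ ^ 2 ≤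
      ∑ k ∈ (freqBall 1).erase 0, ‖sweptCoeff α ν m t k‖ ^ 2 := by
    rw [← Finset.add_sum_erase _ _ (zero_mem_freqBall 1)]
    have h00 : freqNormSq (0 : ℤ²) = 0 := by simp [freqNormSq]
    rw [h00, zero_mul, zero_add]
    refine Finset.sum_le_sum fun k hk => ?_
    have hk1 : freqNormSq k ≤ 1 := by
      have := (mem_freqBall.1 (Finset.mem_of_mem_erase hk))
      simpa using this
    calc freqNormSq k * ‖sweptCoeff α ν m t k‖ ^ 2 ≤ 1 * ‖sweptCoeff α ν m t k‖ ^ 2 := by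
          gcongr
      _ = ‖sweptCoeff α ν m t k‖ ^ 2 := one_mul _
  have hπ : Real.pi ≠ 0 := Real.pi_ne_zero
  calc 4 * Real.pi ^ 2 * ∑ k ∈ freqBall 1, freqNormSq k * ‖sweptCoeff α ν m t k‖ ^ 2
      ≤ 4 * Real.pi ^ 2 * (2 * α ^ 2 / (Real.pi ^ 2 * (m 0) ^ 2)) := by
        gcongr
        exact h1.trans (sum_erase_norm_sq_sweptCoeff_le hν hm ht)
    _ = 8 * α ^ 2 / (m 0) ^ 2 := by
        field_simp
        ring

end State

/-! ### The swept state is a global Leray–Hopf solution -/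

section LerayHopf

/-- **The Galilean swept state is a global Leray–Hopf solution** of the 2-D Navier–Stokes
equations on `𝕋²` with viscosity `ν > 0`, steady force `f_α = marchioroForce α` and constant
datum `u₀ ≡ m` (accepted `Torus.IsGlobalLerayHopf`). Proof: the tree's Hopf–Galerkin scheme
(`IsHopfGalerkinScheme`) is run with the *constant* sequence `U n = u`, `F n = f_α`
(`N n = n + 1`): at every order the explicit coefficients solve the Galerkin system
(`galerkinField_sweptCoeff`, `hasDerivAt_sweptCoeff`), so the Galerkin and energy identities
hold (`NS.galerkin_test_identity`, `NS.galerkin_energy_identity`), and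
`IsHopfGalerkinScheme.isLerayHopfOn_limit` applies with limit `u` itself (the coefficientwise
limit of a constant sequence). [folklore] -/
theorem marchioroSweptState_isGlobalLerayHopf (α : ℝ) {ν : ℝ} (hν : 0 < ν) (m : E²) :
    Torus.IsGlobalLerayHopf ν (fun _ => marchioroForce α) (marchioroSweptState α ν m 0)
      (marchioroSweptState α ν m) := by
  classical
  -- the force
  set f : 𝕋² → E² := marchioroForce α with hf_def
  have hfm : AEStronglyMeasurable (stLift fun _ : ℝ => f) (volume.restrict (Ioi 0 ×ˢ univ)) :=
    aestronglyMeasurable_stLift_marchioroForce α _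
  have hf₂ : ∀ T : ℝ, 0 < T → ∫⁻ _ in Ioo 0 T, ∫⁻ x, ‖f x‖ₑ ^ 2 < ⊤ := fun T _ =>
    lintegral_enorm_sq_marchioroForce_lt_top α T
  -- the datum
  set u₀ : 𝕋² → E² := marchioroSweptState α ν m 0 with hu₀_def
  have hu₀ : MemLp u₀ 2 volume := memLp_marchioroSweptState α ν m 0 2
  have hdiv : IsWeaklyDivFree u₀ :=
    (isDivFree_marchioroSweptState α ν m 0).isWeaklyDivFree_holds (isSmooth_marchioroSweptState α ν m 0)
  -- the frequency sets `S n = freqBall (n + 1)`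
  set S : ℕ → Finset ℤ² := fun n => freqBall (n + 1) with hS_def
  have hS : ∀ n, ∀ k ∈ S n, -k ∈ S n := fun n => neg_mem_freqBall_of_mem
  have h0S : ∀ n, (0 : ℤ²) ∈ S n := fun n => zero_mem_freqBall _
  have h1S : ∀ n, freqBall 1 ⊆ S n := fun n => freqBall_mono (Nat.le_add_left 1 n)
  have hout : ∀ n, ∀ k ∉ S n, k ∉ freqBall (d := Fin 2) 1 := fun n k hk hk1 => hk (h1S n hk1)
  -- force and state coefficient vectors
  set gc : (n : ℕ) → ↥(S n) → ℂ² := fun n k => marchioroForceCoeff α k with hgc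
  set β : (n : ℕ) → ℝ → ↥(S n) → ℂ² := fun n t k => sweptCoeff α ν m t k with hβ
  have hg_real : ∀ n, IsRealCoeff (gc n) := fun n => isRealCoeff_restrict (isConjSymm_marchioroForceCoeff α)
  have hβmem : ∀ n t, β n t ∈ galerkinSubspace (S n) := fun n t =>
    ⟨isRealCoeff_restrict (isConjSymm_sweptCoeff α ν m t),
      isSolenoidalCoeff_restrict fun k _ => sum_mul_sweptCoeff α ν m t k⟩
  have hβcont : ∀ n, ContinuousOn (β n) (Ici 0) := fun n =>
    (continuous_pi fun k : ↥(S n) => continuous_sweptCoeff (α := α) (m := m) hν (k : ℤ²)).continuousOn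
  have hgext : ∀ n, coeffExt (S n) (gc n) = marchioroForceCoeff α := by
    intro n
    funext k
    by_cases hk : k ∈ S n
    · rw [coeffExt_of_mem _ hk]
    · rw [coeffExt_of_not_mem _ hk]
      have hk1 := hout n k hk
      rw [not_mem_freqBall, Nat.cast_one, one_pow] at hk1
      refine (marchioroForceCoeff_eq_zero ?_ ?_).symm
      · rintro rfl
        rw [freqNormSq_firstModeFreq] at hk1
        exact lt_irrefl _ hk1
      · rintro rfl
        rw [freqNormSq_neg, freqNormSq_firstModeFreq] at hk1
        exact lt_irrefl _ hk1
  have hβext : ∀ n t, coeffExt (S n) (β n t) = sweptCoeff α ν m t := by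
    intro n t
    funext k
    by_cases hk : k ∈ S n
    · rw [coeffExt_of_mem _ hk]
    · rw [coeffExt_of_not_mem _ hk]
      exact (sweptCoeff_eq_zero_of_not_mem_freqBall t (hout n k hk)).symm
  -- the Galerkin ODE along the explicit coefficients
  have hβderiv : ∀ n T, ∀ t ∈ Icc (0 : ℝ) T,
      HasDerivWithinAt (β n) (galerkinRHS (S n) ν (gc n) (β n t)) (Icc 0 T) t := by
    intro n T t _
    have hd : HasDerivAt (β n) (fun k : ↥(S n) => sweptCoeffDeriv α ν m t k) t :=
      hasDerivAt_pi.2 fun k => hasDerivAt_sweptCoeff hν (k : ℤ²) t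
    have heq : galerkinRHS (S n) ν (gc n) (β n t) = fun k : ↥(S n) => sweptCoeffDeriv α ν m t k := by
      funext k
      rw [galerkinRHS_apply, hgext n, hβext n t]
      exact galerkinField_sweptCoeff hν (h0S n) k.2 t
    rw [heq]
    exact hd.hasDerivWithinAt
  -- the fields of the scheme
  set F : ℕ → ℝ → 𝕋² → E² := fun n _ => realTrigPoly (S n) (coeffExt (S n) (gc n)) with hF
  set U : ℕ → ℝ → 𝕋² → E² := fun n t => realTrigPoly (S n) (coeffExt (S n) (β n t)) with hU
  have hFf : ∀ n t, F n t = f := by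
    intro n t
    show realTrigPoly (S n) (coeffExt (S n) fun k : ↥(S n) => marchioroForceCoeff α k) = f
    rw [realTrigPoly_coeffExt_restrict]
    show realTrigPoly (freqBall (n + 1))
      (fun k => mFourierCoeff (EuclideanSpace.complexify ∘ marchioroForce α) k) = f
    rw [← fourierTruncate_eq]
    exact fourierTruncate_marchioroForce α (Nat.le_add_left 1 n)
  have hUu : ∀ n t, U n t = marchioroSweptState α ν m t := by
    intro n t
    show realTrigPoly (S n) (coeffExt (S n) fun k : ↥(S n) => sweptCoeff α ν m t k) =
      realTrigPoly (freqBall 1) (sweptCoeff α ν m t)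
    rw [realTrigPoly_coeffExt_restrict, realTrigPoly_eq_comp, realTrigPoly_eq_comp,
      trigPoly_subset (h1S n) fun k _ hk => sweptCoeff_eq_zero_of_not_mem_freqBall t hk]
  have hband : ∀ {n : ℕ} {b : 𝕋² → E²}, IsGalerkinMode (n + 1) b →
      ∀ k ∉ S n, mFourierCoeff (EuclideanSpace.complexify ∘ b) k = 0 :=
    fun hb k hk => hb.mFourierCoeff_eq_zero (not_mem_freqBall.1 hk)
  -- the scheme
  have hScheme : IsHopfGalerkinScheme ν (fun _ => f) u₀ (fun n => n + 1) F U :=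
    { tendsto_order := tendsto_add_atTop_nat 1
      smooth_force := fun n => contDiff_stLift_realTrigPoly (g := fun _ : ℝ => gc n) contDiff_const
      tendsto_force := fun T _ => by
        have h0 : (fun n => ∫⁻ t in Ioo 0 T, ∫⁻ x, ‖F n t x - f x‖ₑ ^ 2) = fun _ => 0 := by
          funext n
          simp only [hFf, sub_self, enorm_zero, ne_eq, OfNat.ofNat_ne_zero, not_false_eq_true,
            zero_pow, lintegral_zero]
        rw [h0]
        exact tendsto_const_nhds
      continuousOn := fun n => continuousOn_stLift_realTrigPoly (hβcont n)
      isGalerkinMode := fun n t _ =>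
        have h := galerkin_slice_props (hS n) (hβmem n t)
        ⟨h.1, h.2.1, fun k hk => h.2.2.2 k (not_mem_freqBall.2 hk)⟩
      isWeaklyDivFree := fun n t _ => (galerkin_slice_props (hS n) (hβmem n t)).2.2.1
      galerkin := fun n b hb s t hs hst =>
        galerkin_test_identity ν (hS n) (g := fun _ => gc n) continuous_const (fun _ => hg_real n)
          (hβmem n) (hβderiv n) hb.isSmooth hb.isDivFree (hband hb) hs hst
      energy_eq := fun n s t hs hst =>
        galerkin_energy_identity ν (hS n) (g := fun _ => gc n) continuous_const (fun _ => hg_real n)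
          (hβmem n) (hβderiv n) hs hst
      initial_inner := fun n b _ => by
        rw [hUu n 0]
      tendsto_initial := by
        have heq : (fun n => eLpNorm (U n 0 - u₀) 2 volume) = fun _ => 0 := by
          funext n
          rw [hUu n 0, hu₀_def, sub_self, eLpNorm_zero]
        rw [heq]
        exact tendsto_const_nhds }
  -- the "limit": the swept state itself
  have hum : AEStronglyMeasurable (stLift (marchioroSweptState α ν m))
      (volume.restrict (Ioi 0 ×ˢ univ)) := by
    have hc : ContinuousOn (stLift (U 0)) (Ici 0 ×ˢ univ) := continuousOn_stLift_realTrigPoly (hβcont 0)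
    have hU0 : U 0 = marchioroSweptState α ν m := funext fun t => hUu 0 t
    rw [hU0] at hc
    exact (hc.mono (Set.prod_mono Ioi_subset_Ici_self subset_rfl)).aestronglyMeasurable
      (measurableSet_Ioi.prod MeasurableSet.univ)
  have hu : ∀ t, 0 ≤ t → MemLp (marchioroSweptState α ν m t) 2 volume := fun t _ =>
    memLp_marchioroSweptState α ν m t 2
  have hcoef : ∀ t, 0 ≤ t → ∀ k, Tendsto
      (fun n => mFourierCoeff (EuclideanSpace.complexify ∘ U n t) k) atTop
      (𝓝 (mFourierCoeff (EuclideanSpace.complexify ∘ marchioroSweptState α ν m t) k)) := by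
    intro t _ k
    simp_rw [hUu]
    exact tendsto_const_nhds
  exact fun T hT => hScheme.isLerayHopfOn_limit hν hu₀ hdiv hfm hf₂ hum hu hcoef hT

end LerayHopf

/-! ### Consequences: bounded mean energy with a first-shell force; necessity of zero momentum -/

section Consequences

variable {α ν : ℝ} {m : E²}

/-- A pointwise bound on `(0, ∞)` for a non-negative observable bounds its long-time average
(`limsup` of Cesàro means). [folklore] -/
theorem longTimeAvgSup_le_of_forall_le {g : ℝ → ℝ} {K : ℝ} (h0 : ∀ t, 0 < t → 0 ≤ g t)
    (h : ∀ t, 0 < t → g t ≤ K) : longTimeAvgSup g ≤ K := by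
  rw [longTimeAvgSup]
  have hb : ∀ t, 0 < t → |g t| ≤ K := fun t ht => by
    rw [abs_of_nonneg (h0 t ht)]
    exact h t ht
  refine limsup_le_of_le (isBoundedUnder_ge_timeMean hb).isCoboundedUnder_le ?_
  exact (eventually_gt_atTop 0).mono fun T hT =>
    (abs_le.1 (abs_timeMean_le hT fun t ht _ => hb t ht)).2

/-- A pointwise bound on the energy on `(0, ∞)` bounds the mean energy
(`⟨‖u‖²⟩ = limsup` of Cesàro means). [folklore] -/
theorem meanEnergy_le_of_forall_le {u : ℝ → 𝕋² → E²} {K : ℝ}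
    (h : ∀ t, 0 < t → ∫ x, ‖u t x‖ ^ 2 ≤ K) : meanEnergy u ≤ K := by
  rw [meanEnergy_eq_longTimeAvgSup]
  exact longTimeAvgSup_le_of_forall_le (fun t _ => integral_nonneg fun _ => sq_nonneg _) h

/-- **The mean energy of the swept state is bounded uniformly in the viscosity**:
`⟨‖u‖²⟩ ≤ ‖m‖² + 2α²/(π² m₀²)` for every `ν > 0` (`m₀ = m 0 ≠ 0`). [folklore] -/
theorem meanEnergy_marchioroSweptState_le (hν : 0 ≤ ν) (hm : m 0 ≠ 0) :
    meanEnergy (marchioroSweptState α ν m) ≤ ‖m‖ ^ 2 + 2 * α ^ 2 / (Real.pi ^ 2 * (m 0) ^ 2) :=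
  meanEnergy_le_of_forall_le fun _ ht => integral_norm_sq_marchioroSweptState_le hν hm ht.le

/-- **The mean dissipation of the swept state vanishes with the viscosity**:
`⟨ν‖∇u‖²⟩ ≤ 8να²/m₀²` (`m₀ = m 0 ≠ 0`) — no anomalous dissipation along the Galilean
evasion. [folklore] -/
theorem meanDissipation_marchioroSweptState_le (hν : 0 ≤ ν) (hm : m 0 ≠ 0) :
    meanDissipation ν (marchioroSweptState α ν m) ≤ ν * (8 * α ^ 2 / (m 0) ^ 2) := by
  refine longTimeAvgSup_le_of_forall_le (fun t _ => mul_nonneg hν ENNReal.toReal_nonneg)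
    fun t ht => ?_
  exact mul_le_mul_of_nonneg_left (toReal_eGradNormSq_marchioroSweptState_le hν hm ht.le) hν

/-- `‖-iα√2 e₁‖² = 2α²`. [folklore] -/
theorem norm_sq_firstModeCoeff (α : ℝ) : ‖firstModeCoeff α‖ ^ 2 = 2 * α ^ 2 := by
  rw [firstModeCoeff, norm_smul, norm_neg, Complex.norm_I, one_mul,
    EuclideanSpace.norm_complexify, norm_smul, PiLp.norm_single, norm_one, mul_one,
    Real.norm_eq_abs, abs_mul, abs_of_nonneg (Real.sqrt_nonneg 2), mul_pow, sq_abs,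
    Real.sq_sqrt zero_le_two]
  ring

/-- The first-mode force with `α ≠ 0` is not the zero field (its mode `e₀` is `-iα√2 e₁/2`). [folklore] -/
theorem marchioroForce_ne_zero {α : ℝ} (hα : α ≠ 0) : marchioroForce α ≠ 0 := by
  intro h
  have h1 : marchioroForceCoeff α firstModeFreq = 0 := by
    rw [marchioroForceCoeff, h]
    simp [Function.comp_def, mFourierCoeff_eq_integral_volume]
  rw [marchioroForceCoeff_eq, if_pos rfl, if_neg firstModeFreq_ne_neg, EuclideanSpace.conjVec_zero,
    add_zero, smul_eq_zero] at h1
  rcases h1 with h1 | h1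
  · norm_num at h1
  · have h2 := norm_sq_firstModeCoeff α
    rw [h1, norm_zero] at h2
    have : α ^ 2 = 0 := by nlinarith
    exact hα (pow_eq_zero_iff two_ne_zero |>.1 this)

/-- **A bounded-energy family with a first-shell force** (the gap in the barrier): there is a
smooth, divergence-free, mean-zero force `g ≠ 0` *in the first eigenspace of the Stokes
operator* (`g = marchioroForce 1`), viscosities `ν_j = 1/(j+1) → 0` and global Leray–Hopf
solutions `v_j` of the 2-D Navier–Stokes equations on `𝕋²` with force `g` — the swept states
with momentum `e₀` — whose mean energies are bounded uniformly in `j`: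
`⟨‖v_j‖²⟩ ≤ 1 + 2/π²`. This is the shape of the route crux `TwoAndHalfD.TwodBoundedEnergy`
(stmt-AnomalousDissipation-0209), which the barrier block of `Marchioro1986_globalAttraction`
was recorded as killing for first-shell forces: the rigidity needs zero total momentum. [folklore] -/
theorem exists_firstMode_boundedMeanEnergy_family :
    ∃ g : 𝕋² → E², IsSmooth g ∧ IsDivFree g ∧ HasZeroMean g ∧ g ≠ 0 ∧
      ∃ (ν : ℕ → ℝ) (v₀ : ℕ → 𝕋² → E²) (v : ℕ → ℝ → 𝕋² → E²),
        (∀ j, 0 < ν j) ∧ Tendsto ν atTop (𝓝 0) ∧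
        (∀ j, Torus.IsGlobalLerayHopf (ν j) (fun _ => g) (v₀ j) (v j)) ∧
        ∃ E : ℝ, ∀ j, meanEnergy (v j) ≤ E := by
  set m : E² := EuclideanSpace.single 0 1 with hm_def
  have hm : m 0 ≠ 0 := by simp [hm_def]
  have hν : ∀ j : ℕ, (0 : ℝ) < 1 / ((j : ℝ) + 1) := fun j => by positivity
  refine ⟨marchioroForce 1, isSmooth_marchioroForce 1, ?_, ?_, marchioroForce_ne_zero one_ne_zero,
    fun j => 1 / ((j : ℝ) + 1), fun j => marchioroSweptState 1 (1 / ((j : ℝ) + 1)) m 0,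
    fun j => marchioroSweptState 1 (1 / ((j : ℝ) + 1)) m, hν,
    tendsto_one_div_add_atTop_nhds_zero_nat,
    fun j => marchioroSweptState_isGlobalLerayHopf 1 (hν j) m,
    ⟨‖m‖ ^ 2 + 2 * (1 : ℝ) ^ 2 / (Real.pi ^ 2 * (m 0) ^ 2), fun j =>
      meanEnergy_marchioroSweptState_le (hν j).le hm⟩⟩
  · rw [marchioroForce_eq_realTrigPoly]
    exact isDivFree_realTrigPoly_singleton (sum_mul_firstModeCoeff 1)
  · exact hasZeroMean_stokesMode (k := Pi.single 0 1) firstModeFreq_ne_zero _ _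

/-- The distance of the swept state to the laminar state never drops below the momentum:
`‖m‖ ≤ ‖u(t) - ū‖_{L²}` (the mean modes differ by `m`). [folklore] -/
theorem enorm_le_eLpNorm_marchioroSweptState_sub_laminarState (α ν : ℝ) (m : E²) (t : ℝ) :
    ‖m‖ₑ ≤ eLpNorm (marchioroSweptState α ν m t - marchioroLaminarState α ν) 2 volume := by
  set v : 𝕋² → E² := marchioroSweptState α ν m t - marchioroLaminarState α ν with hv_def
  have hv : MemLp v 2 volume :=
    (memLp_marchioroSweptState α ν m t 2).sub (memLp_marchioroLaminarState α ν 2)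
  have hcoef : mFourierCoeff (EuclideanSpace.complexify ∘ v) 0 = EuclideanSpace.complexify m := by
    rw [hv_def, complexify_comp_sub,
      mFourierCoeff_sub
        (EuclideanSpace.continuous_complexify.comp
          (isSmooth_marchioroSweptState α ν m t).continuous).integrable_unitAddTorus
        (EuclideanSpace.continuous_complexify.comp
          (marchioroLaminarState_continuous α ν)).integrable_unitAddTorus]
    show mFourierCoeff (EuclideanSpace.complexify ∘ marchioroSweptState α ν m t) 0 -
        mFourierCoeff (EuclideanSpace.complexify ∘ marchioroLaminarState α ν) 0 = _
    rw [mFourierCoeff_marchioroSweptState, sweptCoeff_zero_freq,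
      mFourierCoeff_marchioroLaminarState_eq_zero α ν zero_not_mem_shellOne, sub_zero]
  have hsq : eLpNorm v 2 volume ^ 2 = ∫⁻ x, ‖v x‖ₑ ^ 2 := by
    rw [eLpNorm_eq_lintegral_rpow_enorm_toReal two_ne_zero ENNReal.ofNat_ne_top]
    simp only [ENNReal.toReal_ofNat, one_div]
    rw [← ENNReal.rpow_natCast, ← ENNReal.rpow_mul]
    norm_num
  have h1 : ‖mFourierCoeff (EuclideanSpace.complexify ∘ v) 0‖ₑ ^ 2 ≤
      ∑' k : ℤ², ‖mFourierCoeff (EuclideanSpace.complexify ∘ v) k‖ₑ ^ 2 := ENNReal.le_tsum 0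
  rw [tsum_enorm_sq_mFourierCoeff_complexify hv, hcoef, ← hsq] at h1
  have h2 : ‖EuclideanSpace.complexify m‖ₑ = ‖m‖ₑ := by
    rw [← ofReal_norm, ← ofReal_norm, EuclideanSpace.norm_complexify]
  rw [h2] at h1
  exact (ENNReal.pow_le_pow_left_iff two_ne_zero).1 h1

/-- **Zero total momentum is necessary in Marchioro's theorem**: the statement of
`Marchioro1986_globalAttraction` with the hypothesis `HasZeroMean u₀` deleted is false — for
`α = ν = 1` and the constant datum `u₀ ≡ e₀` the swept state is a global Leray–Hopf solution
which stays at `L²`-distance `≥ 1` from the laminar state `ū = f_α/(4π²ν)` (Marchioro 1986,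
eq. (3): `∫ u dx = 0` is assumed; FMRT 2001, Ch. III (0.9)). [cite: Marchioro1986, eq. (3) and Theorem] -/
theorem not_globalAttraction_without_zeroMean :
    ¬ ∀ (α ν : ℝ) (_hν : 0 < ν) (u₀ : 𝕋² → E²) (_hu₀ : MemLp u₀ 2 volume)
        (_hdiv : IsWeaklyDivFree u₀) (u : ℝ → 𝕋² → E²)
        (_hu : Torus.IsGlobalLerayHopf ν (fun _ => marchioroForce α) u₀ u),
        Tendsto (fun t => eLpNorm (u t - marchioroLaminarState α ν) 2 volume) atTop (𝓝 0) := by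
  intro h
  set m : E² := EuclideanSpace.single 0 1 with hm_def
  have hlim := h 1 1 one_pos (marchioroSweptState 1 1 m 0) (memLp_marchioroSweptState 1 1 m 0 2)
    ((isDivFree_marchioroSweptState 1 1 m 0).isWeaklyDivFree_holds
      (isSmooth_marchioroSweptState 1 1 m 0))
    (marchioroSweptState 1 1 m) (marchioroSweptState_isGlobalLerayHopf 1 one_pos m)
  have hlow : ∀ t, (1 : ℝ≥0∞) ≤
      eLpNorm (marchioroSweptState 1 1 m t - marchioroLaminarState 1 1) 2 volume := fun t => by
    have h1 := enorm_le_eLpNorm_marchioroSweptState_sub_laminarState 1 1 m t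
    have hm1 : ‖m‖ₑ = 1 := by
      rw [← ofReal_norm, hm_def, PiLp.norm_single, norm_one, ENNReal.ofReal_one]
    rwa [hm1] at h1
  have h01 : (1 : ℝ≥0∞) ≤ 0 := ge_of_tendsto' hlim hlow
  exact absurd h01 (by simp)

end Consequences

/-! ### Robustness: every Leray–Hopf solution from the constant datum -/

section Uniqueness

variable {α ν : ℝ} {m : E²}

/-- The swept state solves the Cauchy problem with the constant datum `u₀ ≡ m`. [folklore] -/
theorem marchioroSweptState_isGlobalLerayHopf_const (α : ℝ) {ν : ℝ} (hν : 0 < ν) (m : E²) :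
    Torus.IsGlobalLerayHopf ν (fun _ => marchioroForce α) (fun _ => m) (marchioroSweptState α ν m) :=
  marchioroSweptState_zero α ν m ▸ marchioroSweptState_isGlobalLerayHopf α hν m

/-- **By 2-D uniqueness the evasion is robust**: *every* global Leray–Hopf solution with the
first-mode force and the constant datum `u₀ ≡ m` agrees almost everywhere, at every positive
time, with the swept state (`NS.lions_prodi_uniqueness_torus2_holds`; FMRT Ch. II Thm. 7.3). [cite: FoiasManleyRosaTemam2001, Ch. II Thm. 7.3] -/
theorem ae_eq_marchioroSweptState_of_isGlobalLerayHopf (hν : 0 < ν) {u : ℝ → 𝕋² → E²}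
    (hu : Torus.IsGlobalLerayHopf ν (fun _ => marchioroForce α) (fun _ => m) u) {t : ℝ} (ht : 0 < t) :
    u t =ᵐ[volume] marchioroSweptState α ν m t :=
  lions_prodi_uniqueness_torus2_holds.global hν (aestronglyMeasurable_stLift_marchioroForce α _)
    (fun T _ => lintegral_enorm_sq_marchioroForce_lt_top α T) (memLp_const m)
    ((marchioroSweptState_zero α ν m) ▸
      (isDivFree_marchioroSweptState α ν m 0).isWeaklyDivFree_holds
        (isSmooth_marchioroSweptState α ν m 0))
    hu (marchioroSweptState_isGlobalLerayHopf_const α hν m) ht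

/-- **Every Leray–Hopf solution from the constant datum has ν-uniformly bounded energy**:
`∫ ‖u(t)‖² ≤ ‖m‖² + 2α²/(π²m₀²)` for all `t > 0` (`m₀ = m 0 ≠ 0`). [folklore] -/
theorem integral_norm_sq_le_of_isGlobalLerayHopf_const (hν : 0 < ν) (hm : m 0 ≠ 0)
    {u : ℝ → 𝕋² → E²} (hu : Torus.IsGlobalLerayHopf ν (fun _ => marchioroForce α) (fun _ => m) u)
    {t : ℝ} (ht : 0 < t) :
    ∫ x, ‖u t x‖ ^ 2 ≤ ‖m‖ ^ 2 + 2 * α ^ 2 / (Real.pi ^ 2 * (m 0) ^ 2) := by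
  have hae := ae_eq_marchioroSweptState_of_isGlobalLerayHopf hν hu ht
  have heq : ∫ x, ‖u t x‖ ^ 2 = ∫ x, ‖marchioroSweptState α ν m t x‖ ^ 2 :=
    integral_congr_ae (by filter_upwards [hae] with x hx; simp only [hx])
  rw [heq]
  exact integral_norm_sq_marchioroSweptState_le hν.le hm ht.le

/-- **Every Leray–Hopf solution from the constant datum has bounded mean energy**, uniformly in
the viscosity: `⟨‖u‖²⟩ ≤ ‖m‖² + 2α²/(π²m₀²)`. [folklore] -/
theorem meanEnergy_le_of_isGlobalLerayHopf_const (hν : 0 < ν) (hm : m 0 ≠ 0)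
    {u : ℝ → 𝕋² → E²} (hu : Torus.IsGlobalLerayHopf ν (fun _ => marchioroForce α) (fun _ => m) u) :
    meanEnergy u ≤ ‖m‖ ^ 2 + 2 * α ^ 2 / (Real.pi ^ 2 * (m 0) ^ 2) :=
  meanEnergy_le_of_forall_le fun _ ht => integral_norm_sq_le_of_isGlobalLerayHopf_const hν hm hu ht

/-- **No Leray–Hopf solution from the constant datum `e₀` approaches the laminar state**: the
`L²`-distance stays `≥ 1` at every positive time (robust form of
`not_globalAttraction_without_zeroMean`). [folklore] -/
theorem one_le_eLpNorm_sub_laminarState_of_isGlobalLerayHopf (hν : 0 < ν) {u : ℝ → 𝕋² → E²}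
    (hu : Torus.IsGlobalLerayHopf ν (fun _ => marchioroForce α)
      (fun _ => EuclideanSpace.single 0 1) u) {t : ℝ} (ht : 0 < t) :
    (1 : ℝ≥0∞) ≤ eLpNorm (u t - marchioroLaminarState α ν) 2 volume := by
  have hae := ae_eq_marchioroSweptState_of_isGlobalLerayHopf hν hu ht
  have h1 := enorm_le_eLpNorm_marchioroSweptState_sub_laminarState α ν (EuclideanSpace.single 0 1) t
  have hm1 : ‖(EuclideanSpace.single 0 1 : E²)‖ₑ = 1 := by
    rw [← ofReal_norm, PiLp.norm_single, norm_one, ENNReal.ofReal_one]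
  rw [hm1] at h1
  refine h1.trans_eq (eLpNorm_congr_ae ?_)
  filter_upwards [hae] with x hx
  simp only [Pi.sub_apply, hx]

end Uniqueness

end Literature.Barriers.AnomalousDissipation

end
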